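/-
Copyright (c) 2026 the pub-hodgecm-mathlib formalisation cell (harness21).  Prover seat hodgecm-mathlib-LH4-p14 (g8) (L1 valve hand; (P-dec) writer ∕ K1b in-line second reader;
LEAD F0P6-plan (g15) BATCH #241 (3) default «(α)»), Track B «K2-LIT» ∕ hLiu418 #184♮, socket #41 KIND 1, package (K1b-♮), letter (P-dec) ∕ (dec-2) service:
THE CORNER-INDEX SERVICE — «prove the fine letter at the canonical corner index only».  THEOREMS ONLY.
-/
import Summits.HodgeConjecture.HodgeConjecture.Theorems.K2LiuKindOneLineFrameIndependence        -- ★ p863703 (dec-0) `whittakerDelta_line_eq_of_rowSections` (⊇ the pin frame)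
import Summits.HodgeConjecture.HodgeConjecture.Theorems.K2LiuRankOneCornerIndexTransport          -- ★ p862643 `exists_rat_levi_blocks_levi_map`, `conj_index_eq_single`
import Summits.HodgeConjecture.HodgeConjecture.Theorems.K2LiuSiegelLeviConjUnipDeltaChar          -- ★ `unipDeltaChar_conj_eq`
import Summits.HodgeConjecture.HodgeConjecture.Theorems.K2LiuSiegelDoubledRationalPoints              -- ★ `gramRL_facts` (`T_L` invertible) — ED. 2
import HarnessLib

/-!
# Crux `HLiu418`, socket #41, KIND 1 — (P-dec) ∕ (dec-2) service `K2LiuKindOneLineCornerIndexService`: PROVE THE FINE LETTER AT THE CANONICAL CORNER INDEX ONLY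

Cell `hodgecm-mathlib`, crux item hLiu418 = `stmt-HodgeConjecture-24832` (helper lane `--supports … --as helper`, count-neutral), route of record `HCCMUnconditional`;
squad K2 ∕ K2Liu, road `K2_Liu`, socket #41, KIND 1, package (K1b-♮).  After ★ p863980 (P-dec HEAD) and the one-frame assembly `K2LiuKindOneLineDecayOneFrame`
(K2Liu-p14 (g5)), the (P-dec) residue is the block letter `hBL₁` — the (dec-2) fine letter of the corner-translate family in ONE frame, still quantified over every
transported index `S'` with the re-indexing letter `hψ`.  THIS FILE lets its payers work at the CANONICAL CORNER INDEX `σ♭ E₁₁` only: for every rank-one `T_L`-skew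
`S = u ⊗ w` and the row section `γ` of the frame it produces, BY NAME, the rational Levi block `D₀` of `Λγ[w]` with the Levi relation (★ p862643
`exists_rat_levi_blocks_levi_map`), the corner law `D₀ S γ[w]⁻¹ = σ♭ E₁₁` with `σ♭ ≠ 0` (★ `conj_index_eq_single`), the fact that the corner index IS a transported index
(`hψ` at `S' := σ♭ E₁₁`, ★ `unipDeltaChar_conj_eq`), and — the service — that EVERY transported index `S'` gives the SAME rank-one line Whittaker value as the corner index on
the whole window `{0 < re s}` (★ p863703 frame independence).  So a bound proved at `σ♭ E₁₁` is a bound for every `S'` of `hBL₁` ∕ `hdecF₀` ∕ `hWdec1`.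
* **`exists_cornerIndex_service`** (`e (1,0) = 1`; socket prefix + the `B`-line frame of ★ p863230 BY VALUE).
* §2 (ED. 2): `levi_block_unique` (two solutions of the Levi relation coincide) and the ∀-twin **`cornerIndex_service_of_corner`** — the service at a GIVEN
  corner datum `(D₀, σ♭)` (the binders of ★ p863568 ∕ `hBL₁`), so payers never align two `σ♭`'s by hand.
HONEST LABEL.  Count-neutral helper; closes no socket: `HC_CM` is proved only modulo the 7 printed citations (2 remaining named inputs: hLiu418 =
`stmt-HodgeConjecture-24832`, h413 = `stmt-HodgeConjecture-24833`) until rung 0 closes.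

## References
* [KudlaRallis1994] S. Kudla, S. Rallis, Ann. of Math. 140 (1994): §2 (2.10)–(2.12).
* [MoeglinWaldspurger1995] C. Mœglin, J.-L. Waldspurger, *Spectral decomposition and Eisenstein series* (1995): II.1.7, IV.1.9.
* [HarrisKudlaSweet1996] M. Harris, S. Kudla, W. Sweet, J. AMS 9 (1996): §1 (1.11)–(1.12) (rational Levi blocks).
* [Shimura1997] G. Shimura, CBMS 93 (1997): §18.3–18.4.
-/

set_option autoImplicit false
-- the mandated namespace repeats the single-problem summit's segment (`HodgeConjecture.HodgeConjecture`)
set_option linter.dupNamespace false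

noncomputable section

open scoped Matrix ENNReal NNReal Topology ComplexConjugate
open NumberField IsDedekindDomain MeasureTheory MeasureTheory.Measure Filter Set Function
open Literature.NumberTheory.Automorphic Literature.NumberTheory.Automorphic.UnitaryGroup Literature.NumberTheory.GaloisRepresentations
open Literature.NumberTheory.GelbartRogawski1991 Literature.NumberTheory.GelbartRogawski1991.GRConstruction
open Literature.NumberTheory.GelbartRogawski1991.AdaptedBlocks
open Literature.NumberTheory.K2Lit.SiegelDoubled Literature.MeasureTheory.Group
open Literature.NumberTheory.Automorphic.IdeleClassGroup
open UnitaryDualPair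

namespace Summit.HodgeConjecture.HodgeConjecture.Cruxes.HLiu418.K2LiuKindOneLineCornerIndexService

open K2LiuSiegelUnipotentFourierDefs K2LiuSiegelUnipotentCharacters K2LiuUnipotentCoveringWeight K2LiuSiegelFourierCoeffDelta
open K2LiuSiegelRationalLeviDecomposition K2LiuSiegelMiddleCellSortedPattern K2LiuSiegelMiddleCellLeviCriterion K2LiuSiegelBruhatMiddleCellDelta
open K2LiuKindOneLineFrameIndependence (whittakerDelta_line_eq_of_rowSections)
open K2LiuRankOneCornerIndexTransport (exists_rat_levi_blocks_levi_map conj_index_eq_single)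
open K2LiuSiegelLeviConjUnipDeltaChar (unipDeltaChar_conj_eq)

/-- **THE CORNER-INDEX SERVICE** (corner enumeration `e (1,0) = 1`).  Socket prefix of #41 at `n = 2` and the `B`-line frame `(eA eB dA dB, Λ, μ, nB, γ)` BY VALUE
(★ p863230's bytes).  For every `T_L`-skew rank-one `S = u ⊗ w` (`u, w ≠ 0`): `∃ D₀ σ♭` with the Levi relation `c(γ[w])ᵀ · T_L · D₀ = T_L`, the corner law
`D₀ · S · γ[w]⁻¹ = σ♭ E₁₁`, `σ♭ ≠ 0`, the re-indexing letter `ψ_S(Λγ[w]⁻¹ v Λγ[w]) = ψ_{σ♭E₁₁}(v)` on `N_Δ(𝔸)`, and for EVERY transported index `S'` (same letter with `S'`)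
the identity of rank-one line Whittaker values `W(S')(s, x) = W(σ♭ E₁₁)(s, x)` on `{0 < re s}`.
[cite: HarrisKudlaSweet1996, §1 (1.11)–(1.12)] [cite: KudlaRallis1994, §2 (2.10)–(2.12)] [cite: MoeglinWaldspurger1995, II.1.7, IV.1.9] [cite: Shimura1997, §18.3–18.4] -/
theorem exists_cornerIndex_service
    (L : Type) [Field L] [NumberField L] [IsCMField L] (e : Fin 2 × Fin 1 ≃ Fin 2)
    (dV : Fin 2 → L) (hdV : ∀ i, IsCMField.complexConj L (dV i) = dV i) (hdV0 : ∀ i, dV i ≠ 0)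
    (dW : Fin 1 → L) (hdW : ∀ i, IsCMField.complexConj L (dW i) = dW i) (hdW0 : ∀ i, dW i ≠ 0)
    (lam : IdeleClassGroup L →ₜ* Circle) (_hlam : IsConjugateSymplectic L lam) (_hw : HasWeight L lam 1)
    (𝒦 : IwasawaDatum L e dV hdV dW hdW) (_h𝒦 : 𝒦.IsStd) (f : ℂ → HA L e dV hdV dW hdW → ℂ)
    (hstd : IsStandardSectionFamily 𝒦 (toHeckeCharacter L lam⁻¹) f) (hcont : ∀ s, Continuous (f s))
    [MeasurableSpace (unipDelta L e dV hdV dW hdW)] [BorelSpace (unipDelta L e dV hdV dW hdW)]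
    (νN : Measure (unipDelta L e dV hdV dW hdW)) [νN.IsHaarMeasure]
    (β : unipDelta L e dV hdV dW hdW → ℝ≥0∞) (hβ : IsCoveringWeight (unipDeltaRat L e dV hdV dW hdW) β)
    (_hβ0 : ∫⁻ u, β u ∂νN ≠ 0) (hβtop : ∫⁻ u, β u ∂νN ≠ ∞)
    {K : Set (unipDelta L e dV hdV dW hdW)} (hK : IsCompact K) (hβK : ∀ u, β u ≤ K.indicator 1 u)
    (wq : unipDeltaRat L e dV hdV dW hdW → ratH L e dV hdV dW hdW)
    (hwq : ∀ ν, ((wq ν : ratH L e dV hdV dW hdW) : HA L e dV hdV dW hdW) = weylDelta L e dV hdV dW hdW * ((ν : unipDelta L e dV hdV dW hdW) : HA L e dV hdV dW hdW))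
    -- the corner enumeration (the `e (1, 0) = 0` enumeration is the `inl` twin ★ `K2LiuRankOneMiddleTermWhittakerLineInl`)
    (he : e (1, 0) = 1)
    -- the see-saw datum `V = A ⊕ B` BY VALUE (the writer takes `eA = eB` the unique equivalence, `dA _ := dV 0`, `dB _ := dV 1`, `borel` instances)
    {n₁ n₂ : ℕ} (eA : Fin 1 × Fin 1 ≃ Fin n₁) (eB : Fin 1 × Fin 1 ≃ Fin n₂)
    (dA : Fin 1 → L) (hdA : ∀ i, IsCMField.complexConj L (dA i) = dA i)
    (dB : Fin 1 → L) (hdB : ∀ i, IsCMField.complexConj L (dB i) = dB i) (hdB0 : ∀ i, dB i ≠ 0)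
    (hVA : ∀ i, dV (Fin.castAdd 1 i) = dA i) (hVB : ∀ j, dV (Fin.natAdd 1 j) = dB j)
    [MeasurableSpace (unipDelta L eB dB hdB dW hdW)] [BorelSpace (unipDelta L eB dB hdB dW hdW)]
    -- the Levi chart BY VALUE (★ `exists_leviHom`)
    (Λ : GL (Fin 2) (AdeleRing (𝓞 L) L) →* HA L e dV hdV dW hdW)
    (hΛ : ∀ g : GL (Fin 2) (AdeleRing (𝓞 L) L), blk L e dV hdV dW hdW (Λ g) =
      cayR (AdeleRing (𝓞 L) L) (Fin 2) * Matrix.fromBlocks (g : Matrix (Fin 2) (Fin 2) (AdeleRing (𝓞 L) L)) 0 0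
        (((gramR L e dV hdV dW hdW).map ((algebraMap L (AdeleRing (𝓞 L) L)).comp (algebraMap (Fp L) L)))⁻¹ *
          (((g⁻¹ : GL (Fin 2) (AdeleRing (𝓞 L) L)) : Matrix (Fin 2) (Fin 2) (AdeleRing (𝓞 L) L)).map
            (conjAdele (Fp L) L (IsCMField.complexConj L)))ᵀ *
          (gramR L e dV hdV dW hdW).map ((algebraMap L (AdeleRing (𝓞 L) L)).comp (algebraMap (Fp L) L))) *
        cayRinv (AdeleRing (𝓞 L) L) (Fin 2))
    -- the additive Haar measure on `𝔸_{L⁺}` and the line chart of `H(B)` BY VALUE (★ p862662 `exists_lineChart`)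
    [MeasurableSpace (AdeleRing (𝓞 (Fp L)) (Fp L))] [BorelSpace (AdeleRing (𝓞 (Fp L)) (Fp L))]
    (μ : Measure (AdeleRing (𝓞 (Fp L)) (Fp L))) [μ.IsAddHaarMeasure]
    (nB : AdeleRing (𝓞 (Fp L)) (Fp L) → unipDelta L eB dB hdB dW hdW) (hnBc : Continuous nB) (hnBadd : ∀ s t, nB (s + t) = nB s * nB t)
    (hnB : ∀ t, (blk L eB dB hdB dW hdW (nB t : HA L eB dB hdB dW hdW)).toBlocks₁₂ =
      Matrix.of fun _ _ => AdeleRing.baseChange (Fp L) L t * algebraMap L (AdeleRing (𝓞 L) L) (imagUnit L))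
    -- the row section BY VALUE (★ `exists_rowSection`)
    (γ : Projectivization L (Fin 2 → L) → GL (Fin 2) L)
    (hγ : ∀ p, Projectivization.mk L ((γ p : Matrix (Fin 2) (Fin 2) L) 1) (row_ne_zero (γ p) 1) = p) :
    ∀ (S : skewMatrices ((IsCMField.complexConj L : L ≃ₐ[Fp L] L) : L →+* L) ((gramR L e dV hdV dW hdW).map (algebraMap (Fp L) L)))
      {u w : Fin 2 → L} (_ : (S : Matrix (Fin 2) (Fin 2) L) = Matrix.vecMulVec u w) (_ : u ≠ 0) (hw : w ≠ 0),
      ∃ (D₀ : Matrix (Fin 2) (Fin 2) L) (σf : L),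
        -- the Levi relation of ★ p862643 (the bytes of ★ (ρ4-𝔸))
        (((γ (Projectivization.mk L w hw) : GL (Fin 2) L) : Matrix (Fin 2) (Fin 2) L).map ((IsCMField.complexConj L : L ≃ₐ[Fp L] L) : L →+* L))ᵀ *
            (gramR L e dV hdV dW hdW).map (algebraMap (Fp L) L) * D₀ = (gramR L e dV hdV dW hdW).map (algebraMap (Fp L) L) ∧
        -- the corner law and `σ♭ ≠ 0`
        D₀ * (S : Matrix (Fin 2) (Fin 2) L) * ((γ (Projectivization.mk L w hw) : GL (Fin 2) L) : Matrix (Fin 2) (Fin 2) L)⁻¹ = Matrix.single 1 1 σf ∧ σf ≠ 0 ∧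
        -- the corner index IS a transported index (`hψ` at `S' := σ♭ E₁₁`)
        (∀ v : HA L e dV hdV dW hdW, v ∈ unipDelta L e dV hdV dW hdW →
          unipDeltaChar L e dV hdV dW hdW (S : Matrix (Fin 2) (Fin 2) L) ((Λ (Matrix.GeneralLinearGroup.map (algebraMap L (AdeleRing (𝓞 L) L)) (γ (Projectivization.mk L w hw))))⁻¹ * v * Λ (Matrix.GeneralLinearGroup.map (algebraMap L (AdeleRing (𝓞 L) L)) (γ (Projectivization.mk L w hw)))) =
            unipDeltaChar L e dV hdV dW hdW (Matrix.single 1 1 σf) v) ∧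
        -- every transported index gives the SAME line Whittaker value as the corner index (★ p863703)
        ∀ (S' : Matrix (Fin 2) (Fin 2) L),
          (∀ v : HA L e dV hdV dW hdW, v ∈ unipDelta L e dV hdV dW hdW →
            unipDeltaChar L e dV hdV dW hdW (S : Matrix (Fin 2) (Fin 2) L) ((Λ (Matrix.GeneralLinearGroup.map (algebraMap L (AdeleRing (𝓞 L) L)) (γ (Projectivization.mk L w hw))))⁻¹ * v * Λ (Matrix.GeneralLinearGroup.map (algebraMap L (AdeleRing (𝓞 L) L)) (γ (Projectivization.mk L w hw)))) =
              unipDeltaChar L e dV hdV dW hdW S' v) →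
          ∀ {s : ℂ}, 0 < s.re → ∀ x : HA L e dV hdV dW hdW,
            whittakerDelta L eB dB hdB dW hdW (Measure.map nB μ) ((Matrix.reindex (idxSplit e eA eB) (idxSplit e eA eB) S').toBlocks₂₂)
            (fun y => f s (blkD L e eA eB dA hdA dB hdB dV hdV hVA hVB dW hdW (1, y) *
              (Λ (Matrix.GeneralLinearGroup.map (algebraMap L (AdeleRing (𝓞 L) L)) (γ (Projectivization.mk L w hw))) * x))) 1 =
            whittakerDelta L eB dB hdB dW hdW (Measure.map nB μ) ((Matrix.reindex (idxSplit e eA eB) (idxSplit e eA eB) (Matrix.single 1 1 σf)).toBlocks₂₂)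
            (fun y => f s (blkD L e eA eB dA hdA dB hdB dV hdV hVA hVB dW hdW (1, y) *
              (Λ (Matrix.GeneralLinearGroup.map (algebraMap L (AdeleRing (𝓞 L) L)) (γ (Projectivization.mk L w hw))) * x))) 1 := by
  intro S u w hS1 hu hw
  -- the rational Levi blocks of `Λĝ` (★ p862643): `A₀ = ĝ`, `D₀` with the Levi relation and a unit determinant
  obtain ⟨ha, D₀, hd, hrel, hD₀⟩ := exists_rat_levi_blocks_levi_map Λ hΛ hdV0 hdW0 (γ (Projectivization.mk L w hw))
  -- the corner law (★ `conj_index_eq_single`)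
  obtain ⟨hcorner, hσ⟩ := conj_index_eq_single Λ hΛ hdV0 hdW0 S.2 hS1 hu hw γ hγ hd hD₀
  -- the transported character IS the character of the corner index (★ `unipDeltaChar_conj_eq`)
  have hψ₀ : ∀ v : HA L e dV hdV dW hdW, v ∈ unipDelta L e dV hdV dW hdW →
      unipDeltaChar L e dV hdV dW hdW (S : Matrix (Fin 2) (Fin 2) L) ((Λ (Matrix.GeneralLinearGroup.map (algebraMap L (AdeleRing (𝓞 L) L)) (γ (Projectivization.mk L w hw))))⁻¹ * v * Λ (Matrix.GeneralLinearGroup.map (algebraMap L (AdeleRing (𝓞 L) L)) (γ (Projectivization.mk L w hw)))) =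
        unipDeltaChar L e dV hdV dW hdW (Matrix.single 1 1 ((D₀ * (S : Matrix (Fin 2) (Fin 2) L) * ((γ (Projectivization.mk L w hw) : GL (Fin 2) L) : Matrix (Fin 2) (Fin 2) L)⁻¹) 1 1)) v := by
    intro v hv
    rw [← hcorner]
    exact unipDeltaChar_conj_eq L e dV hdV dW hdW (isSiegelDelta_levi_apply L e dV hdV dW hdW Λ hΛ _)
      (Matrix.isUnits_det_units (γ (Projectivization.mk L w hw))) ha hd (S : Matrix (Fin 2) (Fin 2) L) hv
  refine ⟨D₀, (D₀ * (S : Matrix (Fin 2) (Fin 2) L) * ((γ (Projectivization.mk L w hw) : GL (Fin 2) L) : Matrix (Fin 2) (Fin 2) L)⁻¹) 1 1, hrel, hcorner, hσ, hψ₀, fun S' hψ s hs x => ?_⟩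
  exact whittakerDelta_line_eq_of_rowSections L e dV hdV hdV0 dW hdW hdW0 lam _hlam _hw 𝒦 _h𝒦 f hstd hcont νN β hβ _hβ0 hβtop hK hβK wq hwq he
    eA eB dA hdA dB hdB hdB0 hVA hVB Λ hΛ μ nB hnBc hnBadd hnB γ hγ γ hγ S hS1 hu hw S' hψ _ (hψ₀) hs x

/-! ## §2 Edition 2 (append-only): the ∀-twin — the service at a GIVEN corner datum `(D₀, σ♭)` (K2Liu-audit1 (g4) composability suggestion) -/

/-- **THE RATIONAL LEVI BLOCK IS UNIQUE**: two solutions `D₁, D₂` of the Levi relation `c(g)ᵀ · T_L · D = T_L` coincide (`c(g)ᵀ · T_L` is invertible: `dV, dW ≠ 0`).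
[cite: HarrisKudlaSweet1996, §1 (1.11)] -/
theorem levi_block_unique (L : Type) [Field L] [NumberField L] [IsCMField L] {N M n : ℕ} (e : Fin N × Fin M ≃ Fin n)
    (dV : Fin N → L) (hdV : ∀ i, IsCMField.complexConj L (dV i) = dV i) (hdV0 : ∀ i, dV i ≠ 0)
    (dW : Fin M → L) (hdW : ∀ i, IsCMField.complexConj L (dW i) = dW i) (hdW0 : ∀ i, dW i ≠ 0)
    (g : GL (Fin n) L) {D₁ D₂ : Matrix (Fin n) (Fin n) L}
    (h₁ : ((g : Matrix (Fin n) (Fin n) L).map ((IsCMField.complexConj L : L ≃ₐ[Fp L] L) : L →+* L))ᵀ * (gramR L e dV hdV dW hdW).map (algebraMap (Fp L) L) * D₁ =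
      (gramR L e dV hdV dW hdW).map (algebraMap (Fp L) L))
    (h₂ : ((g : Matrix (Fin n) (Fin n) L).map ((IsCMField.complexConj L : L ≃ₐ[Fp L] L) : L →+* L))ᵀ * (gramR L e dV hdV dW hdW).map (algebraMap (Fp L) L) * D₂ =
      (gramR L e dV hdV dW hdW).map (algebraMap (Fp L) L)) :
    D₁ = D₂ := by
  set X : Matrix (Fin n) (Fin n) L :=
    ((g : Matrix (Fin n) (Fin n) L).map ((IsCMField.complexConj L : L ≃ₐ[Fp L] L) : L →+* L))ᵀ * (gramR L e dV hdV dW hdW).map (algebraMap (Fp L) L) with hX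
  have hT : IsUnit ((gramR L e dV hdV dW hdW).map (algebraMap (Fp L) L)).det :=
    (K2LiuSiegelDoubledRationalPoints.gramRL_facts L e dV hdV dW hdW hdV0 hdW0).1
  have hg : IsUnit (((g : Matrix (Fin n) (Fin n) L).map ((IsCMField.complexConj L : L ≃ₐ[Fp L] L) : L →+* L))ᵀ).det := by
    rw [Matrix.det_transpose, ← RingHom.mapMatrix_apply, ← RingHom.map_det]
    exact (Matrix.isUnits_det_units g).map _
  have hXu : IsUnit X.det := by rw [hX, Matrix.det_mul]; exact hg.mul hT
  calc D₁ = X⁻¹ * (X * D₁) := (Matrix.nonsing_inv_mul_cancel_left X D₁ hXu).symm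
    _ = X⁻¹ * (X * D₂) := by rw [h₁, h₂]
    _ = D₂ := Matrix.nonsing_inv_mul_cancel_left X D₂ hXu

/-- **THE CORNER-INDEX SERVICE AT A GIVEN CORNER DATUM** (the ∀-twin of `exists_cornerIndex_service`): for a rank-one `T_L`-skew `S = u ⊗ w` and ANY `(D₀, σ♭)` satisfying the
Levi relation and the corner law (the by-value binders of ★ p863568 (ρ4-𝔸) and of the one-frame assembly's `hBL₁`): `σ♭ ≠ 0`, the corner index IS a transported index, and
every transported index `S'` gives the same rank-one line Whittaker value as `σ♭ E₁₁` on `{0 < re s}` (`levi_block_unique`: the payer's `D₀` is the service's).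
[cite: HarrisKudlaSweet1996, §1 (1.11)–(1.12)] [cite: KudlaRallis1994, §2 (2.10)–(2.12)] [cite: MoeglinWaldspurger1995, II.1.7, IV.1.9] -/
theorem cornerIndex_service_of_corner
    (L : Type) [Field L] [NumberField L] [IsCMField L] (e : Fin 2 × Fin 1 ≃ Fin 2)
    (dV : Fin 2 → L) (hdV : ∀ i, IsCMField.complexConj L (dV i) = dV i) (hdV0 : ∀ i, dV i ≠ 0)
    (dW : Fin 1 → L) (hdW : ∀ i, IsCMField.complexConj L (dW i) = dW i) (hdW0 : ∀ i, dW i ≠ 0)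
    (lam : IdeleClassGroup L →ₜ* Circle) (_hlam : IsConjugateSymplectic L lam) (_hw : HasWeight L lam 1)
    (𝒦 : IwasawaDatum L e dV hdV dW hdW) (_h𝒦 : 𝒦.IsStd) (f : ℂ → HA L e dV hdV dW hdW → ℂ)
    (hstd : IsStandardSectionFamily 𝒦 (toHeckeCharacter L lam⁻¹) f) (hcont : ∀ s, Continuous (f s))
    [MeasurableSpace (unipDelta L e dV hdV dW hdW)] [BorelSpace (unipDelta L e dV hdV dW hdW)]
    (νN : Measure (unipDelta L e dV hdV dW hdW)) [νN.IsHaarMeasure]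
    (β : unipDelta L e dV hdV dW hdW → ℝ≥0∞) (hβ : IsCoveringWeight (unipDeltaRat L e dV hdV dW hdW) β)
    (_hβ0 : ∫⁻ u, β u ∂νN ≠ 0) (hβtop : ∫⁻ u, β u ∂νN ≠ ∞)
    {K : Set (unipDelta L e dV hdV dW hdW)} (hK : IsCompact K) (hβK : ∀ u, β u ≤ K.indicator 1 u)
    (wq : unipDeltaRat L e dV hdV dW hdW → ratH L e dV hdV dW hdW)
    (hwq : ∀ ν, ((wq ν : ratH L e dV hdV dW hdW) : HA L e dV hdV dW hdW) = weylDelta L e dV hdV dW hdW * ((ν : unipDelta L e dV hdV dW hdW) : HA L e dV hdV dW hdW))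
    -- the corner enumeration (the `e (1, 0) = 0` enumeration is the `inl` twin ★ `K2LiuRankOneMiddleTermWhittakerLineInl`)
    (he : e (1, 0) = 1)
    -- the see-saw datum `V = A ⊕ B` BY VALUE (the writer takes `eA = eB` the unique equivalence, `dA _ := dV 0`, `dB _ := dV 1`, `borel` instances)
    {n₁ n₂ : ℕ} (eA : Fin 1 × Fin 1 ≃ Fin n₁) (eB : Fin 1 × Fin 1 ≃ Fin n₂)
    (dA : Fin 1 → L) (hdA : ∀ i, IsCMField.complexConj L (dA i) = dA i)
    (dB : Fin 1 → L) (hdB : ∀ i, IsCMField.complexConj L (dB i) = dB i) (hdB0 : ∀ i, dB i ≠ 0)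
    (hVA : ∀ i, dV (Fin.castAdd 1 i) = dA i) (hVB : ∀ j, dV (Fin.natAdd 1 j) = dB j)
    [MeasurableSpace (unipDelta L eB dB hdB dW hdW)] [BorelSpace (unipDelta L eB dB hdB dW hdW)]
    -- the Levi chart BY VALUE (★ `exists_leviHom`)
    (Λ : GL (Fin 2) (AdeleRing (𝓞 L) L) →* HA L e dV hdV dW hdW)
    (hΛ : ∀ g : GL (Fin 2) (AdeleRing (𝓞 L) L), blk L e dV hdV dW hdW (Λ g) =
      cayR (AdeleRing (𝓞 L) L) (Fin 2) * Matrix.fromBlocks (g : Matrix (Fin 2) (Fin 2) (AdeleRing (𝓞 L) L)) 0 0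
        (((gramR L e dV hdV dW hdW).map ((algebraMap L (AdeleRing (𝓞 L) L)).comp (algebraMap (Fp L) L)))⁻¹ *
          (((g⁻¹ : GL (Fin 2) (AdeleRing (𝓞 L) L)) : Matrix (Fin 2) (Fin 2) (AdeleRing (𝓞 L) L)).map
            (conjAdele (Fp L) L (IsCMField.complexConj L)))ᵀ *
          (gramR L e dV hdV dW hdW).map ((algebraMap L (AdeleRing (𝓞 L) L)).comp (algebraMap (Fp L) L))) *
        cayRinv (AdeleRing (𝓞 L) L) (Fin 2))
    -- the additive Haar measure on `𝔸_{L⁺}` and the line chart of `H(B)` BY VALUE (★ p862662 `exists_lineChart`)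
    [MeasurableSpace (AdeleRing (𝓞 (Fp L)) (Fp L))] [BorelSpace (AdeleRing (𝓞 (Fp L)) (Fp L))]
    (μ : Measure (AdeleRing (𝓞 (Fp L)) (Fp L))) [μ.IsAddHaarMeasure]
    (nB : AdeleRing (𝓞 (Fp L)) (Fp L) → unipDelta L eB dB hdB dW hdW) (hnBc : Continuous nB) (hnBadd : ∀ s t, nB (s + t) = nB s * nB t)
    (hnB : ∀ t, (blk L eB dB hdB dW hdW (nB t : HA L eB dB hdB dW hdW)).toBlocks₁₂ =
      Matrix.of fun _ _ => AdeleRing.baseChange (Fp L) L t * algebraMap L (AdeleRing (𝓞 L) L) (imagUnit L))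
    -- the row section BY VALUE (★ `exists_rowSection`)
    (γ : Projectivization L (Fin 2 → L) → GL (Fin 2) L)
    (hγ : ∀ p, Projectivization.mk L ((γ p : Matrix (Fin 2) (Fin 2) L) 1) (row_ne_zero (γ p) 1) = p)
    (S : skewMatrices ((IsCMField.complexConj L : L ≃ₐ[Fp L] L) : L →+* L) ((gramR L e dV hdV dW hdW).map (algebraMap (Fp L) L)))
    {u w : Fin 2 → L} (hS1 : (S : Matrix (Fin 2) (Fin 2) L) = Matrix.vecMulVec u w) (hu : u ≠ 0) (hw : w ≠ 0)
    (D₀ : Matrix (Fin 2) (Fin 2) L) (σf : L)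
    (hrel : (((γ (Projectivization.mk L w hw) : GL (Fin 2) L) : Matrix (Fin 2) (Fin 2) L).map ((IsCMField.complexConj L : L ≃ₐ[Fp L] L) : L →+* L))ᵀ *
        (gramR L e dV hdV dW hdW).map (algebraMap (Fp L) L) * D₀ = (gramR L e dV hdV dW hdW).map (algebraMap (Fp L) L))
    (hcorner : D₀ * (S : Matrix (Fin 2) (Fin 2) L) * ((γ (Projectivization.mk L w hw) : GL (Fin 2) L) : Matrix (Fin 2) (Fin 2) L)⁻¹ = Matrix.single 1 1 σf) :
    σf ≠ 0 ∧
      (∀ v : HA L e dV hdV dW hdW, v ∈ unipDelta L e dV hdV dW hdW →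
        unipDeltaChar L e dV hdV dW hdW (S : Matrix (Fin 2) (Fin 2) L) ((Λ (Matrix.GeneralLinearGroup.map (algebraMap L (AdeleRing (𝓞 L) L)) (γ (Projectivization.mk L w hw))))⁻¹ * v * Λ (Matrix.GeneralLinearGroup.map (algebraMap L (AdeleRing (𝓞 L) L)) (γ (Projectivization.mk L w hw)))) =
          unipDeltaChar L e dV hdV dW hdW (Matrix.single 1 1 σf) v) ∧
      ∀ (S' : Matrix (Fin 2) (Fin 2) L),
        (∀ v : HA L e dV hdV dW hdW, v ∈ unipDelta L e dV hdV dW hdW →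
          unipDeltaChar L e dV hdV dW hdW (S : Matrix (Fin 2) (Fin 2) L) ((Λ (Matrix.GeneralLinearGroup.map (algebraMap L (AdeleRing (𝓞 L) L)) (γ (Projectivization.mk L w hw))))⁻¹ * v * Λ (Matrix.GeneralLinearGroup.map (algebraMap L (AdeleRing (𝓞 L) L)) (γ (Projectivization.mk L w hw)))) =
            unipDeltaChar L e dV hdV dW hdW S' v) →
        ∀ {s : ℂ}, 0 < s.re → ∀ x : HA L e dV hdV dW hdW,
          whittakerDelta L eB dB hdB dW hdW (Measure.map nB μ) ((Matrix.reindex (idxSplit e eA eB) (idxSplit e eA eB) S').toBlocks₂₂)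
            (fun y => f s (blkD L e eA eB dA hdA dB hdB dV hdV hVA hVB dW hdW (1, y) *
              (Λ (Matrix.GeneralLinearGroup.map (algebraMap L (AdeleRing (𝓞 L) L)) (γ (Projectivization.mk L w hw))) * x))) 1 =
          whittakerDelta L eB dB hdB dW hdW (Measure.map nB μ) ((Matrix.reindex (idxSplit e eA eB) (idxSplit e eA eB) (Matrix.single 1 1 σf)).toBlocks₂₂)
            (fun y => f s (blkD L e eA eB dA hdA dB hdB dV hdV hVA hVB dW hdW (1, y) *
              (Λ (Matrix.GeneralLinearGroup.map (algebraMap L (AdeleRing (𝓞 L) L)) (γ (Projectivization.mk L w hw))) * x))) 1 := by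
  obtain ⟨D₀', σ', hrel', hcorner', hσ', hψ₀', hserv'⟩ := exists_cornerIndex_service L e dV hdV hdV0 dW hdW hdW0 lam _hlam _hw 𝒦 _h𝒦 f hstd hcont νN β hβ
    _hβ0 hβtop hK hβK wq hwq he eA eB dA hdA dB hdB hdB0 hVA hVB Λ hΛ μ nB hnBc hnBadd hnB γ hγ S hS1 hu hw
  have hD : D₀ = D₀' := levi_block_unique L e dV hdV hdV0 dW hdW hdW0 (γ (Projectivization.mk L w hw)) hrel hrel'
  have hσ : σf = σ' := by
    have h := hcorner.symm.trans (hD ▸ hcorner')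
    simpa only [Matrix.single_apply_same] using congrFun (congrFun h 1) 1
  subst hσ
  exact ⟨hσ', hψ₀', hserv'⟩

end Summit.HodgeConjecture.HodgeConjecture.Cruxes.HLiu418.K2LiuKindOneLineCornerIndexService

end
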